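import Literature.NumberTheory.DiophantineGeometry.GenEllDeCoverFarFromCuspsFamilyPlaces
import Literature.NumberTheory.DiophantineGeometry.GenEllDeFibresFamily

/-!
# [GenEll] Thm 2.1 for `ℙ¹` (route piece W7, family `t_c`, finite set of primes `S`, adapter):
# `φ_c(P)` is `FarFromCusps S ρ'` — point-indexed, in the cell's common conventions

Support file for `GenEllTwo` (stmt-ABC-19679; S. Mochizuki, *Arithmetic elliptic curves in general
position*, Math. J. Okayama Univ. **52** (2010), Thm. 2.1 (ii) ⇒ (i), proof p. 12; package map
`GENELLTWO-P1ROUTE.md` of seat abc-iut-S6, W7 «properness»; RULING #6 «per (c, T)»; R-a′ contract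
adopted by S6 2026-08-26 01:09Z: `GenEllPhiMechanismPlaces.vojtaIneq_of_belyi_mechanism_of_subset`
takes `hZfar : (Z P).FarFromCusps S ρ'` for a finite set of primes `S ⊇ {2}`).

`GenEllDeCoverFarFromCuspsFamilyPlaces.exists_farFromCusps_phi_c_places_of_x_far` restated
* in the D3 conventions (`e = 2k+1`, `t_c z = ((1 − 2·z.1) + algebraMap ℚ _ c * z.2^(k+2)) /
  (z.2 * (1 − 2·z.1))`, as in `GenEllConfigurationProtection.map_tval` / `GenEllDeFibresFamily`);
* with the avoidance hypotheses through ANY finite sets `Xℂ ⊂ ℂ` and `X ℓ ⊂ ℚ̄_ℓ^∧` (`ℓ ∈ S`;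
  a family `X : ∀ ℓ [Fact ℓ.Prime], Finset (PadicAlgCl ℓ)`, the binder convention of the cell's
  `S`-indexed spines) containing the `x`-coordinates of the `t_c`-fibre over the roots of
  `p·q·(p − q)`, in `dist` form, point-indexed by `P : NFPoint`
  (`exists_farFromCusps_phi_c_of_base_places`, and `…_imageAt_mem_UPle_places` = `hZfar ∧ hZmem`);
* instantiated with W5-F-c's `De.XphiC` over the canonical `B =` roots of `p·q·(p − q)`
  (`…_XphiC_roots_places`).

Classical and undisputed; nothing here bears on [IUTchIII] Cor. 3.12.
-/

namespace Literature.NumberTheory.DiophantineGeometry.GenEll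

open Polynomial

universe u

section Forms

variable {L : Type u} [Field L]

/-- The two forms of `t_c` agree off the poles. [folklore] -/
private theorem tc_eq_div' (k : ℕ) (c : L) {x r : L} (hr : r ≠ 0) (hs : 1 - 2 * x ≠ 0) :
    r⁻¹ + c * r ^ (k + 1) / (1 - 2 * x) = ((1 - 2 * x) + c * r ^ (k + 2)) / (r * (1 - 2 * x)) := by
  field_simp
  ring

/-- A non-pole point of `D_e` whose `t_c`-value is a root of `p`, `q` or `p − q` has its
`x`-coordinate in `De.XphiC k c B` for every finite `B` containing these roots (`c ≠ 0`).
[folklore] -/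
private theorem fst_mem_XphiC' [CharZero L] (k : ℕ) {c : ℚ} (hc : c ≠ 0) {p q : ℚ[X]}
    {B : Finset L}
    (hB : ∀ z : L, (aeval z p = 0 ∨ aeval z q = 0 ∨ aeval z (p - q) = 0) → z ∈ B)
    (P' : L × L) (hcurve : P'.2 ^ (2 * k + 1) = P'.1 * (1 - P'.1)) (hr : P'.2 ≠ 0)
    (hs : 1 - 2 * P'.1 ≠ 0)
    (hfib : aeval (((1 - 2 * P'.1) + algebraMap ℚ L c * P'.2 ^ (k + 2)) / (P'.2 * (1 - 2 * P'.1)))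
          p = 0 ∨
      aeval (((1 - 2 * P'.1) + algebraMap ℚ L c * P'.2 ^ (k + 2)) / (P'.2 * (1 - 2 * P'.1)))
          q = 0 ∨
      aeval (((1 - 2 * P'.1) + algebraMap ℚ L c * P'.2 ^ (k + 2)) / (P'.2 * (1 - 2 * P'.1)))
          (p - q) = 0) :
    P'.1 ∈ De.XphiC k (algebraMap ℚ L c) B := by
  have hcL : algebraMap ℚ L c ≠ 0 := (_root_.map_ne_zero _).mpr hc
  rw [De.mem_XphiC]
  exact ⟨P'.2, (De.mem_EphiC_iff_t hcL).mpr ⟨hcurve, hr, hs, hB _ hfib⟩⟩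

/-- The roots in `L` of `p·q·(p − q)` contain every root of `p`, of `q` and of `p − q`.
[folklore] -/
private theorem mem_roots_toFinset'' [CharZero L] [DecidableEq L] {p q : ℚ[X]} (hp0 : p ≠ 0)
    (hq0 : q ≠ 0) (hne : p ≠ q) (z : L)
    (hz : aeval z p = 0 ∨ aeval z q = 0 ∨ aeval z (p - q) = 0) :
    z ∈ ((p * q * (p - q)).map (algebraMap ℚ L)).roots.toFinset := by
  have hpq : p * q * (p - q) ≠ 0 := mul_ne_zero (mul_ne_zero hp0 hq0) (sub_ne_zero.mpr hne)
  rw [Multiset.mem_toFinset, mem_roots ((Polynomial.map_ne_zero_iff (algebraMap ℚ L).injective).mpr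
    hpq), IsRoot.def, eval_map_algebraMap, map_mul, map_mul, map_sub]
  rcases hz with h | h | h
  · rw [h, zero_mul, zero_mul]
  · rw [h, mul_zero, zero_mul]
  · rw [map_sub] at h
    rw [h, mul_zero]

end Forms

section NumberField

/-- A point `ρ`-far from the cusps with `ρ ≥ 0` has `x ≠ 0, 1`. [folklore] -/
private theorem inU_of_farFromCusps' {S : Finset ℕ} {ρ : ℝ} {P : NFPoint}
    (h : NFPoint.FarFromCusps S ρ P) (hρ : 0 ≤ ρ) : P.InU := by
  obtain ⟨σ⟩ := (inferInstance : Nonempty (P.F →+* ℂ))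
  obtain ⟨h0, -, h1⟩ := h.1 σ
  refine ⟨fun hx => ?_, fun hx => ?_⟩
  · rw [hx, map_zero, norm_zero] at h0
    exact absurd h0 (not_lt.mpr hρ)
  · rw [hx, map_one, sub_self, norm_zero] at h1
    exact absurd h1 (not_lt.mpr hρ)

/-- **W7 for the family `t_c` at a finite set of primes `S`, point-indexed, common conventions**
([GenEll] Thm 2.1 proof p. 12).  Fix `k` (`e = 2k+1`), `c ∈ ℚ^×`, `β = p/q` (`p, q ∈ ℚ[X]` of the
same degree `n` as `p − q`, `p, q ≠ 0`, `p ≠ q`), `ρ > 0`, a degree bound `N`, a finite set of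
primes `S`, and finite sets `Xℂ ⊂ ℂ`, `X ℓ ⊂ ℚ̄_ℓ^∧` (`ℓ ∈ S`) containing the `x`-coordinates of
the non-pole curve points `P'` with `β(t_c(P')) ∈ {0, ∞, 1}`.  Then there is `ρ' ∈ (0, 1/2]` such
that for every `P : NFPoint` whose conjugates are `ρ`-far (in `dist`) from `Xℂ` and from every
`X ℓ`, every number field `F` of degree `≤ N`, every `ι : P.F →+* F` and every `r ∈ F` with
`r^{2k+1} = ιx(1 − ιx)`, `r ≠ 0`, `1 − 2·ιx ≠ 0`, the point `⟨F, β(t_c)⟩` is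
`NFPoint.FarFromCusps S ρ'`. [cite: MochizukiGenEll2010, Thm 2.1 proof p.12] -/
theorem exists_farFromCusps_phi_c_of_base_places (k : ℕ) {c : ℚ} (hc : c ≠ 0) {p q : ℚ[X]}
    {n : ℕ} (hpn : p.natDegree = n) (hqn : q.natDegree = n) (hpqn : (p - q).natDegree = n)
    (hp0 : p ≠ 0) (hq0 : q ≠ 0) (hne : p ≠ q) {ρ : ℝ} (hρ : 0 < ρ) (N : ℕ) (S : Finset ℕ)
    (hS : ∀ ℓ ∈ S, ℓ.Prime) {Xℂ : Finset ℂ}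
    (hXℂ : ∀ P' : ℂ × ℂ, P'.2 ^ (2 * k + 1) = P'.1 * (1 - P'.1) → P'.2 ≠ 0 → 1 - 2 * P'.1 ≠ 0 →
      (aeval (((1 - 2 * P'.1) + algebraMap ℚ ℂ c * P'.2 ^ (k + 2)) / (P'.2 * (1 - 2 * P'.1))) p
          = 0 ∨
        aeval (((1 - 2 * P'.1) + algebraMap ℚ ℂ c * P'.2 ^ (k + 2)) / (P'.2 * (1 - 2 * P'.1))) q
          = 0 ∨
        aeval (((1 - 2 * P'.1) + algebraMap ℚ ℂ c * P'.2 ^ (k + 2)) / (P'.2 * (1 - 2 * P'.1)))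
          (p - q) = 0) →
      P'.1 ∈ Xℂ)
    (X : ∀ (ℓ : ℕ) [Fact ℓ.Prime], Finset (PadicAlgCl ℓ))
    (hX : ∀ ℓ ∈ S, ∀ [Fact ℓ.Prime], ∀ P' : PadicAlgCl ℓ × PadicAlgCl ℓ,
      P'.2 ^ (2 * k + 1) = P'.1 * (1 - P'.1) → P'.2 ≠ 0 → 1 - 2 * P'.1 ≠ 0 →
      (aeval (((1 - 2 * P'.1) + algebraMap ℚ (PadicAlgCl ℓ) c * P'.2 ^ (k + 2)) /
            (P'.2 * (1 - 2 * P'.1))) p = 0 ∨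
        aeval (((1 - 2 * P'.1) + algebraMap ℚ (PadicAlgCl ℓ) c * P'.2 ^ (k + 2)) /
            (P'.2 * (1 - 2 * P'.1))) q = 0 ∨
        aeval (((1 - 2 * P'.1) + algebraMap ℚ (PadicAlgCl ℓ) c * P'.2 ^ (k + 2)) /
            (P'.2 * (1 - 2 * P'.1))) (p - q) = 0) →
      P'.1 ∈ X ℓ) :
    ∃ ρ' : ℝ, 0 < ρ' ∧ ρ' ≤ 1 / 2 ∧
      ∀ P : NFPoint,
        (∀ σ : P.F →+* ℂ, ∀ ξ ∈ Xℂ, ρ ≤ dist (σ P.x) ξ) →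
        (∀ ℓ ∈ S, ∀ [Fact ℓ.Prime], ∀ σ : P.F →+* PadicAlgCl ℓ, ∀ ξ ∈ X ℓ,
          ρ ≤ dist (σ P.x) ξ) →
      ∀ (F : Type) [Field F] [NumberField F], Module.finrank ℚ F ≤ N →
      ∀ (ι : P.F →+* F) (r : F), r ^ (2 * k + 1) = ι P.x * (1 - ι P.x) → r ≠ 0 →
        1 - 2 * ι P.x ≠ 0 →
      NFPoint.FarFromCusps S ρ'
        ⟨F, aeval (((1 - 2 * ι P.x) + algebraMap ℚ F c * r ^ (k + 2)) / (r * (1 - 2 * ι P.x))) p /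
            aeval (((1 - 2 * ι P.x) + algebraMap ℚ F c * r ^ (k + 2)) / (r * (1 - 2 * ι P.x)))
              q⟩ := by
  obtain ⟨ρ', h0, h1, h⟩ := exists_farFromCusps_phi_c_places_of_x_far (e := 2 * k + 1)
    (k := k + 1) (by omega) (by omega) hc hpn hqn hpqn hp0 hq0 hne hρ N S hS
  refine ⟨ρ', h0, h1, fun P hPℂ hPS F _ _ hF ι r hcurve hr hs => ?_⟩
  have key := h F hF (ι P.x) r hcurve hr hs ?_ ?_
  · rwa [tc_eq_div' k (c : F) hr hs, ← eq_ratCast (algebraMap ℚ F) c] at key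
  · intro σ P' hc' hr' hs' hfib
    rw [← dist_eq_norm, ← RingHom.comp_apply]
    rw [tc_eq_div' k (c : ℂ) hr' hs', ← eq_ratCast (algebraMap ℚ ℂ) c] at hfib
    exact hPℂ (σ.comp ι) P'.1 (hXℂ P' hc' hr' hs' hfib)
  · intro ℓ hℓ inst σ P' hc' hr' hs' hfib
    rw [← dist_eq_norm, ← RingHom.comp_apply]
    rw [tc_eq_div' k (c : PadicAlgCl ℓ) hr' hs', ← eq_ratCast (algebraMap ℚ (PadicAlgCl ℓ)) c]
      at hfib
    exact hPS ℓ hℓ (σ.comp ι) P'.1 (hX ℓ hℓ P' hc' hr' hs' hfib)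

/-- **W7 for the family `t_c` at a finite set of primes `S`, `hZfar ∧ hZmem` form**: under the
hypotheses of `exists_farFromCusps_phi_c_of_base_places`, the re-presented point
`Z := (⟨F, r⟩ : NFPoint).imageAt (β(t_c))` is `FarFromCusps S ρ'` AND lies in `UPle N` — the
hypotheses `hZfar`, `hZmem` of `GenEllPhiMechanismPlaces.vojtaIneq_of_belyi_mechanism_of_subset`
for the mechanism `(c, T)`, with `ρ'` and `d' := N` uniform in `P`.
[cite: MochizukiGenEll2010, Thm 2.1 proof p.12] -/
theorem exists_farFromCusps_phi_c_imageAt_mem_UPle_places (k : ℕ) {c : ℚ} (hc : c ≠ 0)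
    {p q : ℚ[X]} {n : ℕ} (hpn : p.natDegree = n) (hqn : q.natDegree = n)
    (hpqn : (p - q).natDegree = n) (hp0 : p ≠ 0) (hq0 : q ≠ 0) (hne : p ≠ q) {ρ : ℝ} (hρ : 0 < ρ)
    (N : ℕ) (S : Finset ℕ) (hS : ∀ ℓ ∈ S, ℓ.Prime) {Xℂ : Finset ℂ}
    (hXℂ : ∀ P' : ℂ × ℂ, P'.2 ^ (2 * k + 1) = P'.1 * (1 - P'.1) → P'.2 ≠ 0 → 1 - 2 * P'.1 ≠ 0 →
      (aeval (((1 - 2 * P'.1) + algebraMap ℚ ℂ c * P'.2 ^ (k + 2)) / (P'.2 * (1 - 2 * P'.1))) p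
          = 0 ∨
        aeval (((1 - 2 * P'.1) + algebraMap ℚ ℂ c * P'.2 ^ (k + 2)) / (P'.2 * (1 - 2 * P'.1))) q
          = 0 ∨
        aeval (((1 - 2 * P'.1) + algebraMap ℚ ℂ c * P'.2 ^ (k + 2)) / (P'.2 * (1 - 2 * P'.1)))
          (p - q) = 0) →
      P'.1 ∈ Xℂ)
    (X : ∀ (ℓ : ℕ) [Fact ℓ.Prime], Finset (PadicAlgCl ℓ))
    (hX : ∀ ℓ ∈ S, ∀ [Fact ℓ.Prime], ∀ P' : PadicAlgCl ℓ × PadicAlgCl ℓ,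
      P'.2 ^ (2 * k + 1) = P'.1 * (1 - P'.1) → P'.2 ≠ 0 → 1 - 2 * P'.1 ≠ 0 →
      (aeval (((1 - 2 * P'.1) + algebraMap ℚ (PadicAlgCl ℓ) c * P'.2 ^ (k + 2)) /
            (P'.2 * (1 - 2 * P'.1))) p = 0 ∨
        aeval (((1 - 2 * P'.1) + algebraMap ℚ (PadicAlgCl ℓ) c * P'.2 ^ (k + 2)) /
            (P'.2 * (1 - 2 * P'.1))) q = 0 ∨
        aeval (((1 - 2 * P'.1) + algebraMap ℚ (PadicAlgCl ℓ) c * P'.2 ^ (k + 2)) /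
            (P'.2 * (1 - 2 * P'.1))) (p - q) = 0) →
      P'.1 ∈ X ℓ) :
    ∃ ρ' : ℝ, 0 < ρ' ∧ ρ' ≤ 1 / 2 ∧
      ∀ P : NFPoint,
        (∀ σ : P.F →+* ℂ, ∀ ξ ∈ Xℂ, ρ ≤ dist (σ P.x) ξ) →
        (∀ ℓ ∈ S, ∀ [Fact ℓ.Prime], ∀ σ : P.F →+* PadicAlgCl ℓ, ∀ ξ ∈ X ℓ,
          ρ ≤ dist (σ P.x) ξ) →
      ∀ (F : Type) [Field F] [NumberField F], Module.finrank ℚ F ≤ N →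
      ∀ (ι : P.F →+* F) (r : F), r ^ (2 * k + 1) = ι P.x * (1 - ι P.x) → r ≠ 0 →
        1 - 2 * ι P.x ≠ 0 →
      NFPoint.FarFromCusps S ρ'
          ((⟨F, r⟩ : NFPoint).imageAt
            (aeval (((1 - 2 * ι P.x) + algebraMap ℚ F c * r ^ (k + 2)) / (r * (1 - 2 * ι P.x))) p /
              aeval (((1 - 2 * ι P.x) + algebraMap ℚ F c * r ^ (k + 2)) / (r * (1 - 2 * ι P.x)))
                q)) ∧
        (⟨F, r⟩ : NFPoint).imageAt
            (aeval (((1 - 2 * ι P.x) + algebraMap ℚ F c * r ^ (k + 2)) / (r * (1 - 2 * ι P.x))) p /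
              aeval (((1 - 2 * ι P.x) + algebraMap ℚ F c * r ^ (k + 2)) / (r * (1 - 2 * ι P.x)))
                q) ∈ UPle N := by
  obtain ⟨ρ', h0, h1, h⟩ :=
    exists_farFromCusps_phi_c_of_base_places k hc hpn hqn hpqn hp0 hq0 hne hρ N S hS hXℂ X hX
  refine ⟨ρ', h0, h1, fun P hPℂ hPS F _ _ hF ι r hcurve hr hs => ?_⟩
  have key := h P hPℂ hPS F hF ι r hcurve hr hs
  have hU := inU_of_farFromCusps' key h0.le
  exact ⟨NFPoint.farFromCusps_imageAt ⟨F, r⟩ _ key,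
    NFPoint.imageAt_mem_UPle ⟨F, r⟩ hU.1 hU.2 (d := N) hF⟩

/-- **W7 for the family `t_c` at a finite set of primes `S`, through W5-F-c's `X = De.XphiC`
with the canonical `B`** (the roots of `p·q·(p − q)` in `ℂ` resp. `ℚ̄_ℓ^∧`, so `X = X_φ` on the
nose at every place), `hZfar ∧ hZmem` form. [cite: MochizukiGenEll2010, Thm 2.1 proof p.12] -/
theorem exists_farFromCusps_phi_c_XphiC_roots_places (k : ℕ) {c : ℚ} (hc : c ≠ 0)
    {p q : ℚ[X]} {n : ℕ} (hpn : p.natDegree = n) (hqn : q.natDegree = n)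
    (hpqn : (p - q).natDegree = n) (hp0 : p ≠ 0) (hq0 : q ≠ 0) (hne : p ≠ q) {ρ : ℝ} (hρ : 0 < ρ)
    (N : ℕ) (S : Finset ℕ) (hS : ∀ ℓ ∈ S, ℓ.Prime) :
    ∃ ρ' : ℝ, 0 < ρ' ∧ ρ' ≤ 1 / 2 ∧
      ∀ P : NFPoint,
        (∀ σ : P.F →+* ℂ, ∀ ξ ∈ De.XphiC k (algebraMap ℚ ℂ c)
            (open scoped Classical in ((p * q * (p - q)).map (algebraMap ℚ ℂ)).roots.toFinset),
          ρ ≤ dist (σ P.x) ξ) →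
        (∀ ℓ ∈ S, ∀ [Fact ℓ.Prime], ∀ σ : P.F →+* PadicAlgCl ℓ,
          ∀ ξ ∈ De.XphiC k (algebraMap ℚ (PadicAlgCl ℓ) c)
            (open scoped Classical in
              ((p * q * (p - q)).map (algebraMap ℚ (PadicAlgCl ℓ))).roots.toFinset),
          ρ ≤ dist (σ P.x) ξ) →
      ∀ (F : Type) [Field F] [NumberField F], Module.finrank ℚ F ≤ N →
      ∀ (ι : P.F →+* F) (r : F), r ^ (2 * k + 1) = ι P.x * (1 - ι P.x) → r ≠ 0 →
        1 - 2 * ι P.x ≠ 0 →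
      NFPoint.FarFromCusps S ρ'
          ((⟨F, r⟩ : NFPoint).imageAt
            (aeval (((1 - 2 * ι P.x) + algebraMap ℚ F c * r ^ (k + 2)) / (r * (1 - 2 * ι P.x))) p /
              aeval (((1 - 2 * ι P.x) + algebraMap ℚ F c * r ^ (k + 2)) / (r * (1 - 2 * ι P.x)))
                q)) ∧
        (⟨F, r⟩ : NFPoint).imageAt
            (aeval (((1 - 2 * ι P.x) + algebraMap ℚ F c * r ^ (k + 2)) / (r * (1 - 2 * ι P.x))) p /
              aeval (((1 - 2 * ι P.x) + algebraMap ℚ F c * r ^ (k + 2)) / (r * (1 - 2 * ι P.x)))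
                q) ∈ UPle N := by
  classical
  exact exists_farFromCusps_phi_c_imageAt_mem_UPle_places k hc hpn hqn hpqn hp0 hq0 hne hρ N S hS
    (fst_mem_XphiC' k hc (mem_roots_toFinset'' hp0 hq0 hne))
    (fun ℓ _ => De.XphiC k (algebraMap ℚ (PadicAlgCl ℓ) c)
      (((p * q * (p - q)).map (algebraMap ℚ (PadicAlgCl ℓ))).roots.toFinset))
    (fun ℓ _ _ P' hc' hr' hs' hfib => fst_mem_XphiC' k hc (mem_roots_toFinset'' hp0 hq0 hne)
      P' hc' hr' hs' hfib)

end NumberField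

end Literature.NumberTheory.DiophantineGeometry.GenEll
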